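import Summits.QuantumFields.YangMills.Theorems.BalabanLadderIRTwistedSlabRealSliceDeterminant
import Summits.QuantumFields.YangMills.Theorems.BalabanLadderIRTwistedSlabSlicePhaseData
import Summits.QuantumFields.YangMills.Theorems.BalabanLadderIRTwistedSlabGaugeOrbitData
import Literature.Analysis.InnerProduct.EuclideanModel
import HarnessLib

/-!
# The determinant of K19's slice Hessian in a Frobenius-isometric frame: `det A = (det_ℝ Δ|_{suFields})³` at the decorated twist-eating ladders
# (the Gaussian factor of THE NUMBER), via the real Coulomb-slice determinant of K26 and the polarised identity «Hessian of the twisted Wilson action on the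
# Coulomb slice = the quadratic form of `Δ ⊗ 1`»

HELPER toward stub **T1** `TwistedSlabAnchor` (LINE `twisted-slab-continuity`, crux `IRcof` stmt-QuantumFields-26930, census row 43;
LEAD prover ym-ir-line-tsc-p1 g4; `--supports` the crux, `--as helper`).  Sequel of K26 `…RealSliceDeterminant` and K19 `…SlicePhaseData`; lit-4's L22
`EuclideanModel.exists_linearEquiv_euclideanSpace_inner_eq` BY NAME.  Norm scope `Matrix.Norms.Frobenius` (K19's currency); conclusions are determinant identities.
* §1 `hsPairing` — the real Frobenius pairing `⟨a, a'⟩ = Σ_μ Σ_x Re tr((a_μ x)ᴴ a'_μ x)` on `Fin 4 → fields` (symmetric, bi-additive), positive definite on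
  skew-Hermitian data.
* §2 `kerCovDivEquiv : ker(div) ≃ₗ[ℝ] realCoulombSlice L` (K26's `𝔰𝔲`-valued 1-forms with `div = 0` ARE K13's real Coulomb slice), `sliceLaplacian`
  (`(Δ ⊗ 1)|_{realCoulombSlice}` as an endomorphism of K13's slice), `coe_sliceLaplacian_apply`, ★ `det_sliceLaplacian_pair = (det_ℝ Δ)³` (K26).
* §3 ★★ `hessian_eq_hsPairing_sliceLaplacian` — POLARISED HESSIAN IDENTITY on the slice at the decorated ladder:
  `D²chartAction(0)(a, a') = ⟨(Δ⊗1) a, a'⟩` for `a, a'` in the real Coulomb slice (diagonal: K5 `hessian_chartAction_eq_curlForm` + K3b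
  `weitzenboeck_finBox` with `div a = 0` + the pairing `Σ_x Re tr((ΔΦ)ᴴΦ) = Σ_μ S(∇⁺_μ Φ)`; off-diagonal by polarisation of two symmetric forms).
* §4 ★★★ `det_sliceHessian_eq_of_isometric` — for a frame `T_V` with `⟪y, y'⟫ = ⟨T_V y, T_V y'⟩` (Frobenius-isometric), K19's `sliceHessian U T_V k` is
  `T_V⁻¹ ∘ (Δ⊗1)|_{slice} ∘ T_V`, hence `det (sliceHessian U T_V k) = (det_ℝ Δ|_{suFields})³`; ★ `exists_isometricFrame` (L22: such a frame exists on
  `EuclideanSpace ℝ (Fin (finrank (realCoulombSlice L)))`).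
NOT here (honest scope): the Faddeev–Popov Jacobian `|det D| = √det Δ` and the window constants (THE NUMBER's remaining factors), `det Δ` as a product over twisted
momenta; anything uniform in `β` (M3) or `L, t` (M4); T1-box 0∕1, T1 proper 0∕1.

HONEST FRAMING: finite-dimensional linear algebra on one box; nothing here bears on `IRcof`, `IR`, or the Yang–Mills mass gap (Clay: NOT proved); R4 =
`BalabanLadder.UV` only.  References: M. García Pérez, A. González-Arroyo, M. Okawa, JHEP 10 (2017) 150 §2.3, §2.5; K. W. Breitung (1994) Thm 41.
-/

set_option autoImplicit false

noncomputable section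

open scoped Matrix Matrix.Norms.Frobenius InnerProductSpace
open Finset Module
open Literature.MathematicalPhysics.QuantumFieldTheory Literature.MathematicalPhysics.QuantumLattice
open Literature.Analysis.OperatorTheory Literature.Analysis.InnerProduct

namespace Summit.QuantumFields.YangMills.Cruxes.IRcof.TwistedSlab

variable {N : ℕ} {n₀ n₁ n₂ n₃ : ℕ}

/-! ## §1 The real Frobenius pairing on 1-forms -/

section Pairing

/-- The real Frobenius pairing of matrix-valued lattice 1-forms: `⟨a, a'⟩ = Σ_μ Σ_x Re tr((a_μ x)ᴴ · a'_μ x)`. [folklore] -/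
def hsPairing (a a' : Fin 4 → FinTorusSite n₀ n₁ n₂ n₃ → Matrix (Fin N) (Fin N) ℂ) : ℝ :=
  ∑ μ, ∑ x, (((a μ x)ᴴ * a' μ x).trace).re

/-- Symmetry of the pairing. [folklore] -/
theorem hsPairing_comm (a a' : Fin 4 → FinTorusSite n₀ n₁ n₂ n₃ → Matrix (Fin N) (Fin N) ℂ) : hsPairing a a' = hsPairing a' a := by
  unfold hsPairing
  refine Finset.sum_congr rfl fun μ _ => Finset.sum_congr rfl fun x _ => ?_
  have h : ((a' μ x)ᴴ * a μ x)ᴴ = (a μ x)ᴴ * a' μ x := by rw [Matrix.conjTranspose_mul, Matrix.conjTranspose_conjTranspose]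
  rw [← h, Matrix.trace_conjTranspose, Complex.star_def, Complex.conj_re]

/-- Additivity in the first slot. [folklore] -/
theorem hsPairing_add_left (a b a' : Fin 4 → FinTorusSite n₀ n₁ n₂ n₃ → Matrix (Fin N) (Fin N) ℂ) :
    hsPairing (a + b) a' = hsPairing a a' + hsPairing b a' := by
  simp only [hsPairing, Pi.add_apply, Matrix.conjTranspose_add, Matrix.add_mul, Matrix.trace_add, Complex.add_re, Finset.sum_add_distrib]

/-- Homogeneity in the first slot (real scalars). [folklore] -/
theorem hsPairing_smul_left (c : ℝ) (a a' : Fin 4 → FinTorusSite n₀ n₁ n₂ n₃ → Matrix (Fin N) (Fin N) ℂ) :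
    hsPairing (c • a) a' = c * hsPairing a a' := by
  simp only [hsPairing, Pi.smul_apply, Matrix.conjTranspose_smul, Matrix.smul_mul, Matrix.trace_smul, Finset.mul_sum]
  refine Finset.sum_congr rfl fun μ _ => Finset.sum_congr rfl fun x _ => ?_
  rw [star_trivial, Complex.smul_re, smul_eq_mul]

/-- On the diagonal the pairing is K13's sum of Hilbert–Schmidt norms, positive for `a ≠ 0`. [folklore] -/
theorem hsPairing_self_pos {a : Fin 4 → FinTorusSite n₀ n₁ n₂ n₃ → Matrix (Fin N) (Fin N) ℂ} (ha : a ≠ 0) : 0 < hsPairing a a := by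
  unfold hsPairing
  rw [Finset.sum_comm]
  exact sum_hsS_pos_of_ne_zero ha

end Pairing

/-! ## §2 `ker(div) ≃ realCoulombSlice` and the slice Laplacian `(Δ ⊗ 1)|_{slice}` -/

section Slice

variable {U : FinTorusSite n₀ n₁ n₂ n₃ × Fin 4 → Matrix (Fin N) (Fin N) ℂ}

/-- **K26's `𝔰𝔲`-valued 1-forms with `div = 0` ARE K13's real Coulomb slice.** [cite: GarciaperezGonzalezarroyoOkawa2017, §2.5] -/
def kerCovDivEquiv (hU : ∀ e, U e ∈ Matrix.unitaryGroup (Fin N) ℂ) :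
    LinearMap.ker (DiscreteWeitzenboeck.covDiv (suDadj hU)) ≃ₗ[ℝ] realCoulombSlice U where
  toFun a := ⟨fun μ => ((a : Fin 4 → suFields N n₀ n₁ n₂ n₃) μ : FinTorusSite n₀ n₁ n₂ n₃ → Matrix (Fin N) (Fin N) ℂ),
    mem_realCoulombSlice.2 ⟨fun μ x => ((a : Fin 4 → suFields N n₀ n₁ n₂ n₃) μ).2 x, fun x => by
        have h := congrArg (fun Φ : suFields N n₀ n₁ n₂ n₃ => (Φ : FinTorusSite n₀ n₁ n₂ n₃ → Matrix (Fin N) (Fin N) ℂ) x) (LinearMap.mem_ker.1 a.2)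
        simp only [DiscreteWeitzenboeck.covDiv_apply, Submodule.coe_sum, Finset.sum_apply, coe_suDadj, ZeroMemClass.coe_zero, Pi.zero_apply] at h
        exact h⟩⟩
  invFun b := ⟨fun μ => ⟨(b : Fin 4 → FinTorusSite n₀ n₁ n₂ n₃ → Matrix (Fin N) (Fin N) ℂ) μ,
      mem_suFields.2 fun x => ⟨skew_of_mem_realCoulombSlice b.2 μ x, trace_of_mem_realCoulombSlice b.2 μ x⟩⟩,
    LinearMap.mem_ker.2 (by
      apply Subtype.ext; funext x
      simp only [DiscreteWeitzenboeck.covDiv_apply, Submodule.coe_sum, Finset.sum_apply, coe_suDadj, ZeroMemClass.coe_zero, Pi.zero_apply]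
      exact covDiv_of_mem_realCoulombSlice b.2 x)⟩
  map_add' _ _ := rfl
  map_smul' _ _ := rfl
  left_inv _ := rfl
  right_inv _ := rfl

/-- Components of `kerCovDivEquiv`. [folklore] -/
@[simp] theorem coe_kerCovDivEquiv_apply (hU : ∀ e, U e ∈ Matrix.unitaryGroup (Fin N) ℂ) (a : LinearMap.ker (DiscreteWeitzenboeck.covDiv (suDadj hU))) :
    ((kerCovDivEquiv hU a : realCoulombSlice U) : Fin 4 → FinTorusSite n₀ n₁ n₂ n₃ → Matrix (Fin N) (Fin N) ℂ) =
      fun μ => ((a : Fin 4 → suFields N n₀ n₁ n₂ n₃) μ : FinTorusSite n₀ n₁ n₂ n₃ → Matrix (Fin N) (Fin N) ℂ) := rfl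

variable (hU : ∀ e, U e ∈ Matrix.unitaryGroup (Fin N) ℂ) (hflat : IsPhaseFlat U)

/-- **The slice Laplacian** `(Δ ⊗ 1)|_{realCoulombSlice U}` (K26's restricted form Laplacian transported along `kerCovDivEquiv`).
[cite: GarciaperezGonzalezarroyoOkawa2017, §2.5] [cite: MontvayMunster1994, §3.3 (3.245)] -/
def sliceLaplacian : realCoulombSlice U →ₗ[ℝ] realCoulombSlice U :=
  (kerCovDivEquiv hU).conj ((DiscreteWeitzenboeck.formLaplacian (suD hU) (suDadj hU)).restrict
    fun _ ha => DiscreteWeitzenboeck.formLaplacian_mem_ker_covDiv (suDadj_comm hU hflat) (suD_Dadj_comm hU hflat) ha)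

/-- Components of the slice Laplacian: `((Δ⊗1) a)_μ(x) = Σ_ν [S_ν†(∇⁺_ν a_μ)(x) − ∇⁺_ν a_μ(x)]`. [folklore] -/
theorem coe_sliceLaplacian_apply (a : realCoulombSlice U) (μ : Fin 4) (x : FinTorusSite n₀ n₁ n₂ n₃) :
    ((sliceLaplacian hU hflat a : realCoulombSlice U) : Fin 4 → FinTorusSite n₀ n₁ n₂ n₃ → Matrix (Fin N) (Fin N) ℂ) μ x =
      ∑ ν, (covShiftAdj U ν (covDeriv U ν ((a : Fin 4 → FinTorusSite n₀ n₁ n₂ n₃ → Matrix (Fin N) (Fin N) ℂ) μ)) x -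
        covDeriv U ν ((a : Fin 4 → FinTorusSite n₀ n₁ n₂ n₃ → Matrix (Fin N) (Fin N) ℂ) μ) x) := by
  have h1 : ((sliceLaplacian hU hflat a : realCoulombSlice U) : Fin 4 → FinTorusSite n₀ n₁ n₂ n₃ → Matrix (Fin N) (Fin N) ℂ) μ x =
      ((DiscreteWeitzenboeck.covLaplacian (suD hU) (suDadj hU)
        (((kerCovDivEquiv hU).symm a : Fin 4 → suFields N n₀ n₁ n₂ n₃) μ) : suFields N n₀ n₁ n₂ n₃) : FinTorusSite n₀ n₁ n₂ n₃ → Matrix (Fin N) (Fin N) ℂ) x := rfl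
  rw [h1, DiscreteWeitzenboeck.covLaplacian_apply, Submodule.coe_sum, Finset.sum_apply]
  rfl

variable [NeZero N] {m : ℕ} {A B : Matrix (Fin N) (Fin N) ℂ} {ω : ℂ}

omit hflat in
/-- ★ **`det (Δ⊗1)|_{slice} = (det_ℝ Δ|_{suFields})³`** at the decorated twist-eating ladders (K26 transported along `kerCovDivEquiv`). [cite: GarciaperezGonzalezarroyoOkawa2017, §2.5] -/
theorem det_sliceLaplacian_pair {n₂' n₃' : ℕ} (hAu : A ∈ Matrix.unitaryGroup (Fin N) ℂ) (hBu : B ∈ Matrix.unitaryGroup (Fin N) ℂ)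
    (hω : IsPrimitiveRoot ω N) (hAB : A * B = ω • (B * A)) {c₂ c₃ : ℂ} (hNm : 2 ≤ N * (m + 1))
    (hU' : ∀ e, ladderField (n₀ := m + 1) (n₁ := m + 1) (n₂ := n₂') (n₃ := n₃')
      ![A, B, c₂ • (1 : Matrix (Fin N) (Fin N) ℂ), c₃ • (1 : Matrix (Fin N) (Fin N) ℂ)] e ∈ Matrix.unitaryGroup (Fin N) ℂ) :
    LinearMap.det (sliceLaplacian hU' (isPhaseFlat_ladderField_pair (NeZero.ne N) hω.pow_eq_one hAB c₂ c₃)) =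
      LinearMap.det (DiscreteWeitzenboeck.covLaplacian (suD hU') (suDadj hU')) ^ 3 := by
  rw [sliceLaplacian, LinearEquiv.conj_apply]
  exact (LinearMap.det_conj _ (kerCovDivEquiv hU')).trans (det_realCoulombSlice_ladder_pair hAu hBu hω hAB hNm hU')

end Slice

/-! ## §3 The polarised Hessian identity on the slice at the decorated twist-eating ladders -/

section Hessian

variable [NeZero N] {m m₂ m₃ : ℕ} {k : ZMod N} {A B : Matrix.specialUnitaryGroup (Fin N) ℂ} {i j : ZMod N}

omit [NeZero N] in
/-- The Dirichlet pairing of two 1-forms: `Σ_ν Σ_μ Σ_x Re tr((∇⁺_μ a_ν x)ᴴ ∇⁺_μ a'_ν x)`; it is the pairing with the slice Laplacian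
(summation by parts, K3a `sum_hsRe_covDerivAdj`). [folklore; GPGAO 2017 §2.5] -/
theorem hsPairing_sliceLaplacian {L : FinTorusSite (m + 1) (m + 1) (m₂ + 1) (m₃ + 1) × Fin 4 → Matrix (Fin N) (Fin N) ℂ}
    (hLu : ∀ e, L e ∈ Matrix.unitaryGroup (Fin N) ℂ) (hflat : IsPhaseFlat L) (a a' : realCoulombSlice L) :
    hsPairing ((sliceLaplacian hLu hflat a : realCoulombSlice L) : Fin 4 → FinTorusSite (m + 1) (m + 1) (m₂ + 1) (m₃ + 1) → Matrix (Fin N) (Fin N) ℂ)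
        (a' : Fin 4 → FinTorusSite (m + 1) (m + 1) (m₂ + 1) (m₃ + 1) → Matrix (Fin N) (Fin N) ℂ) =
      ∑ ν, ∑ μ, ∑ x, (((covDeriv L μ ((a : Fin 4 → FinTorusSite (m + 1) (m + 1) (m₂ + 1) (m₃ + 1) → Matrix (Fin N) (Fin N) ℂ) ν) x)ᴴ *
        covDeriv L μ ((a' : Fin 4 → FinTorusSite (m + 1) (m + 1) (m₂ + 1) (m₃ + 1) → Matrix (Fin N) (Fin N) ℂ) ν) x).trace).re := by
  unfold hsPairing
  refine Finset.sum_congr rfl fun ν _ => ?_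
  simp only [coe_sliceLaplacian_apply, Matrix.conjTranspose_sum, Finset.sum_mul, Matrix.trace_sum, Complex.re_sum]
  rw [Finset.sum_comm]
  exact Finset.sum_congr rfl fun μ _ => sum_hsRe_covDerivAdj hLu μ _ _

omit [NeZero N] in
/-- The Dirichlet pairing is symmetric. [folklore] -/
theorem hsPairing_sliceLaplacian_comm {L : FinTorusSite (m + 1) (m + 1) (m₂ + 1) (m₃ + 1) × Fin 4 → Matrix (Fin N) (Fin N) ℂ}
    (hLu : ∀ e, L e ∈ Matrix.unitaryGroup (Fin N) ℂ) (hflat : IsPhaseFlat L) (a a' : realCoulombSlice L) :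
    hsPairing ((sliceLaplacian hLu hflat a : realCoulombSlice L) : Fin 4 → FinTorusSite (m + 1) (m + 1) (m₂ + 1) (m₃ + 1) → Matrix (Fin N) (Fin N) ℂ)
        (a' : Fin 4 → FinTorusSite (m + 1) (m + 1) (m₂ + 1) (m₃ + 1) → Matrix (Fin N) (Fin N) ℂ) =
      hsPairing ((sliceLaplacian hLu hflat a' : realCoulombSlice L) : Fin 4 → FinTorusSite (m + 1) (m + 1) (m₂ + 1) (m₃ + 1) → Matrix (Fin N) (Fin N) ℂ)
        (a : Fin 4 → FinTorusSite (m + 1) (m + 1) (m₂ + 1) (m₃ + 1) → Matrix (Fin N) (Fin N) ℂ) := by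
  rw [hsPairing_sliceLaplacian, hsPairing_sliceLaplacian]
  refine Finset.sum_congr rfl fun ν _ => Finset.sum_congr rfl fun μ _ => Finset.sum_congr rfl fun x _ => ?_
  have h : ((covDeriv L μ ((a' : Fin 4 → FinTorusSite (m + 1) (m + 1) (m₂ + 1) (m₃ + 1) → Matrix (Fin N) (Fin N) ℂ) ν) x)ᴴ *
      covDeriv L μ ((a : Fin 4 → FinTorusSite (m + 1) (m + 1) (m₂ + 1) (m₃ + 1) → Matrix (Fin N) (Fin N) ℂ) ν) x)ᴴ =
      (covDeriv L μ ((a : Fin 4 → FinTorusSite (m + 1) (m + 1) (m₂ + 1) (m₃ + 1) → Matrix (Fin N) (Fin N) ℂ) ν) x)ᴴ *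
        covDeriv L μ ((a' : Fin 4 → FinTorusSite (m + 1) (m + 1) (m₂ + 1) (m₃ + 1) → Matrix (Fin N) (Fin N) ℂ) ν) x := by
    rw [Matrix.conjTranspose_mul, Matrix.conjTranspose_conjTranspose]
  rw [← h, Matrix.trace_conjTranspose, Complex.star_def, Complex.conj_re]

omit [NeZero N] in
/-- **On the diagonal**: at the decorated twist-eating ladder `L = ladderField ![A, B, ω^i•1, ω^j•1]` (`k` a unit, `B A B⁻¹ A⁻¹ = ω^k·1`), for `a` in the
real Coulomb slice, `D²chartAction(0)(a, a) = ⟨(Δ⊗1) a, a⟩` (K5 `hessian_chartAction_eq_curlForm`, K3b `weitzenboeck_finBox` with `div a = 0`).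
[cite: GarciaperezGonzalezarroyoOkawa2017, §2.3, §2.5] -/
theorem hessian_self_eq_hsPairing_sliceLaplacian (hAB : B * A * B⁻¹ * A⁻¹ = (suCenter N k : Matrix.specialUnitaryGroup (Fin N) ℂ))
    (hLu : ∀ e, ladderField (n₀ := m + 1) (n₁ := m + 1) (n₂ := m₂ + 1) (n₃ := m₃ + 1) ![(A : Matrix (Fin N) (Fin N) ℂ), (B : Matrix (Fin N) (Fin N) ℂ),
      centerPhase N i • (1 : Matrix (Fin N) (Fin N) ℂ), centerPhase N j • (1 : Matrix (Fin N) (Fin N) ℂ)] e ∈ Matrix.unitaryGroup (Fin N) ℂ)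
    (hflat : IsPhaseFlat (ladderField (n₀ := m + 1) (n₁ := m + 1) (n₂ := m₂ + 1) (n₃ := m₃ + 1) ![(A : Matrix (Fin N) (Fin N) ℂ), (B : Matrix (Fin N) (Fin N) ℂ),
      centerPhase N i • (1 : Matrix (Fin N) (Fin N) ℂ), centerPhase N j • (1 : Matrix (Fin N) (Fin N) ℂ)]))
    (a : realCoulombSlice (ladderField (n₀ := m + 1) (n₁ := m + 1) (n₂ := m₂ + 1) (n₃ := m₃ + 1)
      ![(A : Matrix (Fin N) (Fin N) ℂ), (B : Matrix (Fin N) (Fin N) ℂ), centerPhase N i • (1 : Matrix (Fin N) (Fin N) ℂ), centerPhase N j • (1 : Matrix (Fin N) (Fin N) ℂ)])) :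
    fderiv ℝ (fderiv ℝ (chartAction (ladderField (n₀ := m + 1) (n₁ := m + 1) (n₂ := m₂ + 1) (n₃ := m₃ + 1)
      ![(A : Matrix (Fin N) (Fin N) ℂ), (B : Matrix (Fin N) (Fin N) ℂ), centerPhase N i • (1 : Matrix (Fin N) (Fin N) ℂ), centerPhase N j • (1 : Matrix (Fin N) (Fin N) ℂ)])
        (slabTwistPhase k))) 0 (a : Fin 4 → FinTorusSite (m + 1) (m + 1) (m₂ + 1) (m₃ + 1) → Matrix (Fin N) (Fin N) ℂ)
        (a : Fin 4 → FinTorusSite (m + 1) (m + 1) (m₂ + 1) (m₃ + 1) → Matrix (Fin N) (Fin N) ℂ) =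
      hsPairing ((sliceLaplacian hLu hflat a : realCoulombSlice _) : Fin 4 → FinTorusSite (m + 1) (m + 1) (m₂ + 1) (m₃ + 1) → Matrix (Fin N) (Fin N) ℂ)
        (a : Fin 4 → FinTorusSite (m + 1) (m + 1) (m₂ + 1) (m₃ + 1) → Matrix (Fin N) (Fin N) ℂ) := by
  have hskew : ∀ μ x, ((a : Fin 4 → FinTorusSite (m + 1) (m + 1) (m₂ + 1) (m₃ + 1) → Matrix (Fin N) (Fin N) ℂ) μ x)ᴴ =
      -(a : Fin 4 → FinTorusSite (m + 1) (m + 1) (m₂ + 1) (m₃ + 1) → Matrix (Fin N) (Fin N) ℂ) μ x := fun μ x => skew_of_mem_realCoulombSlice a.2 μ x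
  have hdiv : ∀ x, covDiv (ladderField (n₀ := m + 1) (n₁ := m + 1) (n₂ := m₂ + 1) (n₃ := m₃ + 1)
      ![(A : Matrix (Fin N) (Fin N) ℂ), (B : Matrix (Fin N) (Fin N) ℂ), centerPhase N i • (1 : Matrix (Fin N) (Fin N) ℂ), centerPhase N j • (1 : Matrix (Fin N) (Fin N) ℂ)])
      (a : Fin 4 → FinTorusSite (m + 1) (m + 1) (m₂ + 1) (m₃ + 1) → Matrix (Fin N) (Fin N) ℂ) x = 0 := fun x => covDiv_of_mem_realCoulombSlice a.2 x
  rw [hessian_chartAction_eq_curlForm hLu (star_slabTwistPhase_mul_self k) (fun x μ ν hμν => ladder_eats_slabTwistPhase hAB i j x μ ν hμν) hskew,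
    hsPairing_sliceLaplacian]
  have hW := weitzenboeck_finBox hLu hflat (a : Fin 4 → FinTorusSite (m + 1) (m + 1) (m₂ + 1) (m₃ + 1) → Matrix (Fin N) (Fin N) ℂ)
  have hpairs := sum_hsS_curl_pairs (U := ladderField (n₀ := m + 1) (n₁ := m + 1) (n₂ := m₂ + 1) (n₃ := m₃ + 1)
      ![(A : Matrix (Fin N) (Fin N) ℂ), (B : Matrix (Fin N) (Fin N) ℂ), centerPhase N i • (1 : Matrix (Fin N) (Fin N) ℂ), centerPhase N j • (1 : Matrix (Fin N) (Fin N) ℂ)])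
    (a : Fin 4 → FinTorusSite (m + 1) (m + 1) (m₂ + 1) (m₃ + 1) → Matrix (Fin N) (Fin N) ℂ)
  simp only [hdiv, Matrix.conjTranspose_zero, Matrix.trace_zero, Complex.zero_re, Finset.sum_const_zero, mul_zero, add_zero] at hW
  -- reorder the triple sum `Σ_x Σ_μ Σ_ν ↦ Σ_ν Σ_μ Σ_x`
  have hre : ∑ x : FinTorusSite (m + 1) (m + 1) (m₂ + 1) (m₃ + 1), ∑ μ : Fin 4, ∑ ν : Fin 4,
      (((covDeriv (ladderField (n₀ := m + 1) (n₁ := m + 1) (n₂ := m₂ + 1) (n₃ := m₃ + 1)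
        ![(A : Matrix (Fin N) (Fin N) ℂ), (B : Matrix (Fin N) (Fin N) ℂ), centerPhase N i • (1 : Matrix (Fin N) (Fin N) ℂ), centerPhase N j • (1 : Matrix (Fin N) (Fin N) ℂ)])
        μ ((a : Fin 4 → FinTorusSite (m + 1) (m + 1) (m₂ + 1) (m₃ + 1) → Matrix (Fin N) (Fin N) ℂ) ν) x)ᴴ *
        covDeriv (ladderField (n₀ := m + 1) (n₁ := m + 1) (n₂ := m₂ + 1) (n₃ := m₃ + 1)
          ![(A : Matrix (Fin N) (Fin N) ℂ), (B : Matrix (Fin N) (Fin N) ℂ), centerPhase N i • (1 : Matrix (Fin N) (Fin N) ℂ), centerPhase N j • (1 : Matrix (Fin N) (Fin N) ℂ)])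
          μ ((a : Fin 4 → FinTorusSite (m + 1) (m + 1) (m₂ + 1) (m₃ + 1) → Matrix (Fin N) (Fin N) ℂ) ν) x).trace).re =
      ∑ ν : Fin 4, ∑ μ : Fin 4, ∑ x : FinTorusSite (m + 1) (m + 1) (m₂ + 1) (m₃ + 1),
      (((covDeriv (ladderField (n₀ := m + 1) (n₁ := m + 1) (n₂ := m₂ + 1) (n₃ := m₃ + 1)
        ![(A : Matrix (Fin N) (Fin N) ℂ), (B : Matrix (Fin N) (Fin N) ℂ), centerPhase N i • (1 : Matrix (Fin N) (Fin N) ℂ), centerPhase N j • (1 : Matrix (Fin N) (Fin N) ℂ)])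
        μ ((a : Fin 4 → FinTorusSite (m + 1) (m + 1) (m₂ + 1) (m₃ + 1) → Matrix (Fin N) (Fin N) ℂ) ν) x)ᴴ *
        covDeriv (ladderField (n₀ := m + 1) (n₁ := m + 1) (n₂ := m₂ + 1) (n₃ := m₃ + 1)
          ![(A : Matrix (Fin N) (Fin N) ℂ), (B : Matrix (Fin N) (Fin N) ℂ), centerPhase N i • (1 : Matrix (Fin N) (Fin N) ℂ), centerPhase N j • (1 : Matrix (Fin N) (Fin N) ℂ)])
          μ ((a : Fin 4 → FinTorusSite (m + 1) (m + 1) (m₂ + 1) (m₃ + 1) → Matrix (Fin N) (Fin N) ℂ) ν) x).trace).re := by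
    rw [Finset.sum_comm]
    refine (Finset.sum_congr rfl fun μ _ => Finset.sum_comm).trans ?_
    rw [Finset.sum_comm]
  rw [← hre]
  linarith

omit [NeZero N] in
/-- ★★ **POLARISED HESSIAN IDENTITY ON THE SLICE**: `D²chartAction(0)(a, a') = ⟨(Δ⊗1) a, a'⟩` for `a, a'` in the real Coulomb slice at the decorated ladder
(two symmetric bilinear forms agreeing on the diagonal). [cite: GarciaperezGonzalezarroyoOkawa2017, §2.3, §2.5] [cite: Breitung1994, Thm 41] -/
theorem hessian_eq_hsPairing_sliceLaplacian (hAB : B * A * B⁻¹ * A⁻¹ = (suCenter N k : Matrix.specialUnitaryGroup (Fin N) ℂ))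
    (hLu : ∀ e, ladderField (n₀ := m + 1) (n₁ := m + 1) (n₂ := m₂ + 1) (n₃ := m₃ + 1) ![(A : Matrix (Fin N) (Fin N) ℂ), (B : Matrix (Fin N) (Fin N) ℂ),
      centerPhase N i • (1 : Matrix (Fin N) (Fin N) ℂ), centerPhase N j • (1 : Matrix (Fin N) (Fin N) ℂ)] e ∈ Matrix.unitaryGroup (Fin N) ℂ)
    (hflat : IsPhaseFlat (ladderField (n₀ := m + 1) (n₁ := m + 1) (n₂ := m₂ + 1) (n₃ := m₃ + 1) ![(A : Matrix (Fin N) (Fin N) ℂ), (B : Matrix (Fin N) (Fin N) ℂ),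
      centerPhase N i • (1 : Matrix (Fin N) (Fin N) ℂ), centerPhase N j • (1 : Matrix (Fin N) (Fin N) ℂ)]))
    (a a' : realCoulombSlice (ladderField (n₀ := m + 1) (n₁ := m + 1) (n₂ := m₂ + 1) (n₃ := m₃ + 1)
      ![(A : Matrix (Fin N) (Fin N) ℂ), (B : Matrix (Fin N) (Fin N) ℂ), centerPhase N i • (1 : Matrix (Fin N) (Fin N) ℂ), centerPhase N j • (1 : Matrix (Fin N) (Fin N) ℂ)])) :
    fderiv ℝ (fderiv ℝ (chartAction (ladderField (n₀ := m + 1) (n₁ := m + 1) (n₂ := m₂ + 1) (n₃ := m₃ + 1)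
      ![(A : Matrix (Fin N) (Fin N) ℂ), (B : Matrix (Fin N) (Fin N) ℂ), centerPhase N i • (1 : Matrix (Fin N) (Fin N) ℂ), centerPhase N j • (1 : Matrix (Fin N) (Fin N) ℂ)])
        (slabTwistPhase k))) 0 (a : Fin 4 → FinTorusSite (m + 1) (m + 1) (m₂ + 1) (m₃ + 1) → Matrix (Fin N) (Fin N) ℂ)
        (a' : Fin 4 → FinTorusSite (m + 1) (m + 1) (m₂ + 1) (m₃ + 1) → Matrix (Fin N) (Fin N) ℂ) =
      hsPairing ((sliceLaplacian hLu hflat a : realCoulombSlice _) : Fin 4 → FinTorusSite (m + 1) (m + 1) (m₂ + 1) (m₃ + 1) → Matrix (Fin N) (Fin N) ℂ)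
        (a' : Fin 4 → FinTorusSite (m + 1) (m + 1) (m₂ + 1) (m₃ + 1) → Matrix (Fin N) (Fin N) ℂ) := by
  set H2 := fderiv ℝ (fderiv ℝ (chartAction (ladderField (n₀ := m + 1) (n₁ := m + 1) (n₂ := m₂ + 1) (n₃ := m₃ + 1)
      ![(A : Matrix (Fin N) (Fin N) ℂ), (B : Matrix (Fin N) (Fin N) ℂ), centerPhase N i • (1 : Matrix (Fin N) (Fin N) ℂ), centerPhase N j • (1 : Matrix (Fin N) (Fin N) ℂ)])
        (slabTwistPhase k))) 0 with hH2
  set P : realCoulombSlice (ladderField (n₀ := m + 1) (n₁ := m + 1) (n₂ := m₂ + 1) (n₃ := m₃ + 1)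
      ![(A : Matrix (Fin N) (Fin N) ℂ), (B : Matrix (Fin N) (Fin N) ℂ), centerPhase N i • (1 : Matrix (Fin N) (Fin N) ℂ), centerPhase N j • (1 : Matrix (Fin N) (Fin N) ℂ)]) →
      realCoulombSlice (ladderField (n₀ := m + 1) (n₁ := m + 1) (n₂ := m₂ + 1) (n₃ := m₃ + 1)
      ![(A : Matrix (Fin N) (Fin N) ℂ), (B : Matrix (Fin N) (Fin N) ℂ), centerPhase N i • (1 : Matrix (Fin N) (Fin N) ℂ), centerPhase N j • (1 : Matrix (Fin N) (Fin N) ℂ)]) → ℝ :=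
    fun b b' => hsPairing ((sliceLaplacian hLu hflat b : realCoulombSlice _) : Fin 4 → FinTorusSite (m + 1) (m + 1) (m₂ + 1) (m₃ + 1) → Matrix (Fin N) (Fin N) ℂ)
      (b' : Fin 4 → FinTorusSite (m + 1) (m + 1) (m₂ + 1) (m₃ + 1) → Matrix (Fin N) (Fin N) ℂ) with hP
  -- symmetry of the second derivative (Schwarz) and of the Dirichlet pairing
  have hsymm : ∀ v w : Fin 4 → FinTorusSite (m + 1) (m + 1) (m₂ + 1) (m₃ + 1) → Matrix (Fin N) (Fin N) ℂ, H2 v w = H2 w v :=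
    fun v w => ((contDiff_chartAction (ladderField (n₀ := m + 1) (n₁ := m + 1) (n₂ := m₂ + 1) (n₃ := m₃ + 1)
      ![(A : Matrix (Fin N) (Fin N) ℂ), (B : Matrix (Fin N) (Fin N) ℂ), centerPhase N i • (1 : Matrix (Fin N) (Fin N) ℂ), centerPhase N j • (1 : Matrix (Fin N) (Fin N) ℂ)])
      (slabTwistPhase k)).contDiffAt (x := 0)).isSymmSndFDerivAt (n := ⊤) (by simp) v w
  have hPsymm : ∀ b b', P b b' = P b' b := fun b b' => hsPairing_sliceLaplacian_comm hLu hflat b b'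
  have hPadd : ∀ b c b', P (b + c) b' = P b b' + P c b' := fun b c b' => by
    simp only [hP, map_add, Submodule.coe_add, hsPairing_add_left]
  -- diagonal agreement
  have hdiag : ∀ b : realCoulombSlice (ladderField (n₀ := m + 1) (n₁ := m + 1) (n₂ := m₂ + 1) (n₃ := m₃ + 1)
      ![(A : Matrix (Fin N) (Fin N) ℂ), (B : Matrix (Fin N) (Fin N) ℂ), centerPhase N i • (1 : Matrix (Fin N) (Fin N) ℂ), centerPhase N j • (1 : Matrix (Fin N) (Fin N) ℂ)]),
      H2 (b : Fin 4 → FinTorusSite (m + 1) (m + 1) (m₂ + 1) (m₃ + 1) → Matrix (Fin N) (Fin N) ℂ)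
        (b : Fin 4 → FinTorusSite (m + 1) (m + 1) (m₂ + 1) (m₃ + 1) → Matrix (Fin N) (Fin N) ℂ) = P b b :=
    fun b => hessian_self_eq_hsPairing_sliceLaplacian hAB hLu hflat b
  -- polarisation
  have h1 := hdiag (a + a')
  have hL : H2 ((a : Fin 4 → FinTorusSite (m + 1) (m + 1) (m₂ + 1) (m₃ + 1) → Matrix (Fin N) (Fin N) ℂ) + a')
      ((a : Fin 4 → FinTorusSite (m + 1) (m + 1) (m₂ + 1) (m₃ + 1) → Matrix (Fin N) (Fin N) ℂ) + a') =
      H2 (a : Fin 4 → FinTorusSite (m + 1) (m + 1) (m₂ + 1) (m₃ + 1) → Matrix (Fin N) (Fin N) ℂ) a +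
        2 * H2 (a : Fin 4 → FinTorusSite (m + 1) (m + 1) (m₂ + 1) (m₃ + 1) → Matrix (Fin N) (Fin N) ℂ) a' +
        H2 (a' : Fin 4 → FinTorusSite (m + 1) (m + 1) (m₂ + 1) (m₃ + 1) → Matrix (Fin N) (Fin N) ℂ) a' := by
    rw [map_add, map_add, add_apply, add_apply, hsymm (a' : Fin 4 → FinTorusSite (m + 1) (m + 1) (m₂ + 1) (m₃ + 1) → Matrix (Fin N) (Fin N) ℂ) a]
    ring
  have hR : P (a + a') (a + a') = P a a + 2 * P a a' + P a' a' := by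
    rw [hPadd, hPsymm a (a + a'), hPsymm a' (a + a'), hPadd, hPadd, hPsymm a' a]
    ring
  rw [Submodule.coe_add, hL, hR, hdiag a, hdiag a'] at h1
  show H2 _ _ = P a a'
  linarith

end Hessian

/-! ## §4 The slice Hessian in a Frobenius-isometric frame and its determinant -/

section Det

variable [NeZero N] {m m₂ m₃ : ℕ} {k : ZMod N} {A B : Matrix.specialUnitaryGroup (Fin N) ℂ} {i j : ZMod N}
variable {V : Type*} [NormedAddCommGroup V] [InnerProductSpace ℝ V] [CompleteSpace V]

/-- ★★★ **`det A = (det_ℝ Δ|_{suFields})³` IN A FROBENIUS-ISOMETRIC FRAME.**  At the decorated twist-eating ladder (`k` a unit, `B A B⁻¹ A⁻¹ = ω^k·1`, labels `i, j`,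
box `(m+1)² × (m₂+1) × (m₃+1)`, `N(m+1) ≥ 2`), for every frame `T_V : V ≃L realCoulombSlice L` with `⟪y, y'⟫ = ⟨T_V y, T_V y'⟩` (the real Frobenius pairing):
K19's `sliceHessian` is `T_V⁻¹ ∘ (Δ⊗1)|_{slice} ∘ T_V` and `det (sliceHessian U T_V k) = (det_ℝ Δ)³`. [cite: GarciaperezGonzalezarroyoOkawa2017, §2.5]
[cite: Breitung1994, Thm 41 (the determinant of the matrix of second derivatives)] -/
theorem det_sliceHessian_eq_of_isometric (hk : IsUnit k) (hAB : B * A * B⁻¹ * A⁻¹ = (suCenter N k : Matrix.specialUnitaryGroup (Fin N) ℂ)) (hNm : 2 ≤ N * (m + 1))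
    (T_V : V ≃L[ℝ] realCoulombSlice (ladderField (n₀ := m + 1) (n₁ := m + 1) (n₂ := m₂ + 1) (n₃ := m₃ + 1)
      ![(A : Matrix (Fin N) (Fin N) ℂ), (B : Matrix (Fin N) (Fin N) ℂ), centerPhase N i • (1 : Matrix (Fin N) (Fin N) ℂ), centerPhase N j • (1 : Matrix (Fin N) (Fin N) ℂ)]))
    (hT : ∀ y y' : V, ⟪y, y'⟫_ℝ = hsPairing ((T_V y : realCoulombSlice _) : Fin 4 → FinTorusSite (m + 1) (m + 1) (m₂ + 1) (m₃ + 1) → Matrix (Fin N) (Fin N) ℂ)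
      ((T_V y' : realCoulombSlice _) : Fin 4 → FinTorusSite (m + 1) (m + 1) (m₂ + 1) (m₃ + 1) → Matrix (Fin N) (Fin N) ℂ)) :
    LinearMap.det (sliceHessian (fun e => (⟨ladderField (n₀ := m + 1) (n₁ := m + 1) (n₂ := m₂ + 1) (n₃ := m₃ + 1)
        ![(A : Matrix (Fin N) (Fin N) ℂ), (B : Matrix (Fin N) (Fin N) ℂ), centerPhase N i • (1 : Matrix (Fin N) (Fin N) ℂ), centerPhase N j • (1 : Matrix (Fin N) (Fin N) ℂ)] e,
        ladderFieldPair_mem_specialUnitaryGroup A B i j e⟩ : Matrix.specialUnitaryGroup (Fin N) ℂ)) T_V k) =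
      LinearMap.det (DiscreteWeitzenboeck.covLaplacian
        (suD (fun e => Matrix.specialUnitaryGroup_le_unitaryGroup (ladderFieldPair_mem_specialUnitaryGroup (n₀ := m + 1) (n₁ := m + 1) (n₂ := m₂ + 1) (n₃ := m₃ + 1) A B i j e)))
        (suDadj (fun e => Matrix.specialUnitaryGroup_le_unitaryGroup (ladderFieldPair_mem_specialUnitaryGroup (n₀ := m + 1) (n₁ := m + 1) (n₂ := m₂ + 1) (n₃ := m₃ + 1) A B i j e)))) ^ 3 := by
  have hLu : ∀ e, ladderField (n₀ := m + 1) (n₁ := m + 1) (n₂ := m₂ + 1) (n₃ := m₃ + 1) ![(A : Matrix (Fin N) (Fin N) ℂ), (B : Matrix (Fin N) (Fin N) ℂ),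
      centerPhase N i • (1 : Matrix (Fin N) (Fin N) ℂ), centerPhase N j • (1 : Matrix (Fin N) (Fin N) ℂ)] e ∈ Matrix.unitaryGroup (Fin N) ℂ :=
    fun e => Matrix.specialUnitaryGroup_le_unitaryGroup (ladderFieldPair_mem_specialUnitaryGroup A B i j e)
  have hω := isPrimitiveRoot_star_centerPhase (N := N) hk
  have hAB' := coe_mul_eq_smul_of_commutator_eq hAB
  have hflat := isPhaseFlat_ladderField_pair (n₀ := m + 1) (n₁ := m + 1) (n₂ := m₂ + 1) (n₃ := m₃ + 1) (NeZero.ne N) hω.pow_eq_one hAB' (centerPhase N i) (centerPhase N j)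
  -- `A = T⁻¹ ∘ H ∘ T`
  have hconj : sliceHessian (fun e => (⟨ladderField (n₀ := m + 1) (n₁ := m + 1) (n₂ := m₂ + 1) (n₃ := m₃ + 1)
        ![(A : Matrix (Fin N) (Fin N) ℂ), (B : Matrix (Fin N) (Fin N) ℂ), centerPhase N i • (1 : Matrix (Fin N) (Fin N) ℂ), centerPhase N j • (1 : Matrix (Fin N) (Fin N) ℂ)] e,
        ladderFieldPair_mem_specialUnitaryGroup A B i j e⟩ : Matrix.specialUnitaryGroup (Fin N) ℂ)) T_V k =
      (T_V.symm.toLinearEquiv : realCoulombSlice _ →ₗ[ℝ] V) ∘ₗ sliceLaplacian hLu hflat ∘ₗ (T_V.symm.toLinearEquiv.symm : V →ₗ[ℝ] realCoulombSlice _) := by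
    apply LinearMap.ext fun y => ?_
    apply ext_inner_right ℝ
    intro w
    rw [inner_sliceHessian, sliceDir_apply, sliceDir_apply, hessian_eq_hsPairing_sliceLaplacian hAB hLu hflat, hT]
    simp only [LinearMap.coe_comp, Function.comp_apply, LinearEquiv.coe_coe, ContinuousLinearEquiv.toLinearEquiv_symm, LinearEquiv.symm_symm,
      ContinuousLinearEquiv.coe_symm_toLinearEquiv, ContinuousLinearEquiv.coe_toLinearEquiv, ContinuousLinearEquiv.apply_symm_apply]
  rw [hconj, LinearMap.det_conj]
  exact det_sliceLaplacian_pair (m := m) (n₂' := m₂ + 1) (n₃' := m₃ + 1) (Matrix.specialUnitaryGroup_le_unitaryGroup A.2)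
    (Matrix.specialUnitaryGroup_le_unitaryGroup B.2) hω hAB' hNm hLu

omit [NeZero N] in
/-- ★ **A Frobenius-isometric frame exists** on `EuclideanSpace ℝ (Fin (finrank ℝ (realCoulombSlice L)))` (lit-4 L22 `exists_linearEquiv_euclideanSpace_inner_eq` for the
positive-definite symmetric real Frobenius pairing). [folklore] -/
theorem exists_isometricFrame (L : FinTorusSite n₀ n₁ n₂ n₃ × Fin 4 → Matrix (Fin N) (Fin N) ℂ) :
    ∃ T_V : EuclideanSpace ℝ (Fin (finrank ℝ (realCoulombSlice L))) ≃L[ℝ] realCoulombSlice L,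
      ∀ y y', ⟪y, y'⟫_ℝ = hsPairing ((T_V y : realCoulombSlice L) : Fin 4 → FinTorusSite n₀ n₁ n₂ n₃ → Matrix (Fin N) (Fin N) ℂ)
        ((T_V y' : realCoulombSlice L) : Fin 4 → FinTorusSite n₀ n₁ n₂ n₃ → Matrix (Fin N) (Fin N) ℂ) := by
  haveI : IsUniformAddGroup (realCoulombSlice L) := (realCoulombSlice L).toAddSubgroup.isUniformAddGroup
  haveI : CompleteSpace (realCoulombSlice L) := FiniteDimensional.complete ℝ _
  have hadd_right : ∀ a b c : Fin 4 → FinTorusSite n₀ n₁ n₂ n₃ → Matrix (Fin N) (Fin N) ℂ, hsPairing a (b + c) = hsPairing a b + hsPairing a c := fun a b c => by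
    rw [hsPairing_comm, hsPairing_add_left, hsPairing_comm b, hsPairing_comm c]
  have hsmul_right : ∀ (r : ℝ) (a b : Fin 4 → FinTorusSite n₀ n₁ n₂ n₃ → Matrix (Fin N) (Fin N) ℂ), hsPairing a (r • b) = r * hsPairing a b := fun r a b => by
    rw [hsPairing_comm, hsPairing_smul_left, hsPairing_comm]
  let bform : realCoulombSlice L →ₗ[ℝ] realCoulombSlice L →ₗ[ℝ] ℝ :=
    LinearMap.mk₂ ℝ (fun a a' => hsPairing (a : Fin 4 → FinTorusSite n₀ n₁ n₂ n₃ → Matrix (Fin N) (Fin N) ℂ) (a' : Fin 4 → FinTorusSite n₀ n₁ n₂ n₃ → Matrix (Fin N) (Fin N) ℂ))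
      (fun a b a' => by simp only [Submodule.coe_add, hsPairing_add_left])
      (fun r a a' => by simp only [Submodule.coe_smul, hsPairing_smul_left, smul_eq_mul])
      (fun a b b' => by simp only [Submodule.coe_add, hadd_right])
      (fun r a b => by simp only [Submodule.coe_smul, hsmul_right, smul_eq_mul])
  obtain ⟨e, he⟩ := exists_linearEquiv_euclideanSpace_inner_eq bform (fun a a' => hsPairing_comm _ _)
    (fun a ha => hsPairing_self_pos (by
      intro h0
      exact ha (Subtype.ext h0)))
  refine ⟨e.symm.toContinuousLinearEquiv, fun y y' => ?_⟩
  have h := he (e.symm y) (e.symm y')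
  rw [LinearEquiv.apply_symm_apply, LinearEquiv.apply_symm_apply] at h
  exact h
end Det

end Summit.QuantumFields.YangMills.Cruxes.IRcof.TwistedSlab

end
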